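import Summits.CriticalPhenomena.PercolationContinuityZ3.Theorems.PercNearOneGluingNoHeavyLowerTailCILOwnEdgeStability
import Summits.CriticalPhenomena.PercolationContinuityZ3.Theorems.PercNearOneGluingAdditiveGluingOneBond
import HarnessLib

/-!
# `NoHeavyLowerTail` (stmt-CriticalPhenomena-4575) — hull-port line: WLOG the candidate witness is not a port

Support file (prover `prim-hp-1`, hull-port / coupling line; `--supports stmt-CriticalPhenomena-4575`).  No definitions,
no named facts, no sorries.

Setting (crux evidence HULLPORT-COUPLING.md §8–§9): `μ_w = prodBernoulli w` on `Fin n`, relays `A`, level `j`, lightness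
`I_w(y) = μ_w{|π(y)| ≤ j}`.  The open atom of the hull-port programme ("split-K′" / (Q)) is an inequality between two events
that both contain `{b ≁ x}` for a Steiner vertex `x` (the observer side) and a relay `b` (the candidate witness), under the
hypothesis that `b` dominates a fixed relay `z` in `w`-lightness.  This file proves the reduction
"WLOG `w s(b,x) = 0`" (the candidate witness is not adjacent to the observer):

* `HullPort.measureReal_notReach_inter_eq_erase` — COIN ERASURE: for `b ≠ x` and ANY event `E`,
  `μ_w({b ≁ x} ∩ E) = (1 − w s(b,x)) · μ_{w[s(b,x)↦0]}({b ≁ x} ∩ E)` (on `{s(b,x) open}` the event `{b ≁ x}` is empty;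
  one-bond decomposition `stub_oneBondDecomp_k15`).
* `HullPort.notReach_inter_le_of_erase` — TRANSFER: if the target inequality `μ({b≁x} ∩ E₁) ≤ μ({b≁x} ∩ E₂)` holds for the
  ERASED weights `w₀ = w[s(b,x)↦0]` whenever `I_{w₀}(z) ≤ I_{w₀}(b)`, and `I_w(z) ≤ I_w(b)`, then it holds for `w`.  Proof: both
  sides scale by `1 − w s(b,x)`; if `b` is behind `z` at `w₀`, own-edge stability (`CutObserver.lightness_sub_ge_of_erase_edge`,
  prover `prim-gen-induct`) gives `(1 − w s(b,x))·(I_{w₀}(z) − I_{w₀}(b)) ≤ I_w(z) − I_w(b) ≤ 0`, forcing `w s(b,x) = 1`, and then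
  both sides vanish.
* `HullPort.csPair_of_erase` — the transfer specialised to the pair champion-stability events of
  `stub_championStabilityPair` / the `hsplit` hypothesis of `HullPort.cil_depthTwo_of_split` (observer pair `{x, y}`).
[cite: VandenbergHaggstromKahn2005, Thm. 1.5 — the only probabilistic input, via own-edge stability]
-/

noncomputable section

namespace Summit.CriticalPhenomena.PercolationContinuityZ3.Theorems

open MeasureTheory Set Literature.Probability.LatticeModels Literature.Probability.Percolation
open scoped Classical BigOperators

variable {n : ℕ}

namespace HullPort

open CutObserver ChampionStability

/-- **Coin erasure.**  For `b ≠ x` and any event `E`: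
`μ_w({b ≁ x} ∩ E) = (1 − w s(b,x)) · μ_{w[s(b,x)↦0]}({b ≁ x} ∩ E)`. [folklore] -/
theorem measureReal_notReach_inter_eq_erase (w : Sym2 (Fin n) → unitInterval) (b x : Fin n) (hbx : b ≠ x)
    (E : Set (BondConfig (Fin n))) :
    (prodBernoulli w).real ({ω : BondConfig (Fin n) | ¬ (openGraph ω).Reachable b x} ∩ E) =
      (1 - (w s(b, x) : ℝ)) *
        (prodBernoulli (Function.update w s(b, x) 0)).real
          ({ω : BondConfig (Fin n) | ¬ (openGraph ω).Reachable b x} ∩ E) := by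
  set S := {ω : BondConfig (Fin n) | ¬ (openGraph ω).Reachable b x} ∩ E with hS
  rw [stub_oneBondDecomp_k15 n w s(b, x) S]
  have h1 : Function.update w s(b, x) 1 = Function.update (Function.update w s(b, x) 0) s(b, x) 1 := by
    rw [Function.update_idem]
  have hw0 : (Function.update w s(b, x) 0) s(b, x) = 0 := by simp
  rw [h1, real_update_one_eq _ hw0]
  have hempty : (fun ω : BondConfig (Fin n) => insert s(b, x) ω) ⁻¹' S = ∅ := by
    ext ω
    simp only [hS, mem_preimage, mem_inter_iff, mem_setOf_eq, mem_empty_iff_false, iff_false, not_and]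
    intro h
    exact absurd ((reachable_insert_to_left_iff ω hbx x).2 (Or.inr SimpleGraph.Reachable.rfl)).symm h
  rw [hempty, measureReal_empty, mul_zero, add_zero]

/-- **Transfer from the coin-erased weights.**  Let `b ≠ x`, `z ≠ b`, `w₀ = w[s(b,x) ↦ 0]`.  Suppose the inequality
`μ_{w₀}({b ≁ x} ∩ E₁) ≤ μ_{w₀}({b ≁ x} ∩ E₂)` holds whenever `I_{w₀}(z) ≤ I_{w₀}(b)`, and that `I_w(z) ≤ I_w(b)`.  Then
`μ_w({b ≁ x} ∩ E₁) ≤ μ_w({b ≁ x} ∩ E₂)`. [cite: VandenbergHaggstromKahn2005, Thm. 1.5 — via own-edge stability] -/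
theorem notReach_inter_le_of_erase (w : Sym2 (Fin n) → unitInterval) (A : Finset (Fin n)) (b x z : Fin n) (j : ℕ)
    (hbx : b ≠ x) (hzb : z ≠ b) (E₁ E₂ : Set (BondConfig (Fin n)))
    (hred : (prodBernoulli (Function.update w s(b, x) 0)).real
          {ω : BondConfig (Fin n) | (A.filter fun y => ω ∈ openConn z y).card ≤ j} ≤
        (prodBernoulli (Function.update w s(b, x) 0)).real
          {ω : BondConfig (Fin n) | (A.filter fun y => ω ∈ openConn b y).card ≤ j} →
      (prodBernoulli (Function.update w s(b, x) 0)).real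
          ({ω : BondConfig (Fin n) | ¬ (openGraph ω).Reachable b x} ∩ E₁) ≤
        (prodBernoulli (Function.update w s(b, x) 0)).real
          ({ω : BondConfig (Fin n) | ¬ (openGraph ω).Reachable b x} ∩ E₂))
    (hle : (prodBernoulli w).real {ω : BondConfig (Fin n) | (A.filter fun y => ω ∈ openConn z y).card ≤ j} ≤
      (prodBernoulli w).real {ω : BondConfig (Fin n) | (A.filter fun y => ω ∈ openConn b y).card ≤ j}) :
    (prodBernoulli w).real ({ω : BondConfig (Fin n) | ¬ (openGraph ω).Reachable b x} ∩ E₁) ≤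
      (prodBernoulli w).real ({ω : BondConfig (Fin n) | ¬ (openGraph ω).Reachable b x} ∩ E₂) := by
  set w₀ := Function.update w s(b, x) 0 with hw₀
  set Ib₀ := (prodBernoulli w₀).real
      {ω : BondConfig (Fin n) | (A.filter fun y => ω ∈ openConn b y).card ≤ j} with hIb₀
  set Iz₀ := (prodBernoulli w₀).real
      {ω : BondConfig (Fin n) | (A.filter fun y => ω ∈ openConn z y).card ≤ j} with hIz₀
  have hp0 : 0 ≤ (w s(b, x) : ℝ) := (w s(b, x)).2.1
  have hp1 : (w s(b, x) : ℝ) ≤ 1 := (w s(b, x)).2.2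
  rw [measureReal_notReach_inter_eq_erase w b x hbx E₁, measureReal_notReach_inter_eq_erase w b x hbx E₂]
  by_cases hdom : Iz₀ ≤ Ib₀
  · exact mul_le_mul_of_nonneg_left (hred hdom) (by linarith)
  · -- `b` is strictly behind `z` at `w₀`; own-edge stability keeps it behind at `w` unless the coin is certain
    have hlt : Ib₀ < Iz₀ := lt_of_not_ge hdom
    have hoes := lightness_sub_ge_of_erase_edge w A b x z j hbx hzb hlt.le
    -- `(1 - w e) * (Iz₀ - Ib₀) ≤ I_w(z) - I_w(b) ≤ 0`
    have hq : (1 - (w s(b, x) : ℝ)) * (Iz₀ - Ib₀) ≤ 0 := by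
      have := hoes
      change (1 - (w s(b, x) : ℝ)) * (Iz₀ - Ib₀) ≤ _ at this
      linarith
    have h1 : 1 - (w s(b, x) : ℝ) = 0 := by
      by_contra hne
      have hpos : 0 < 1 - (w s(b, x) : ℝ) := lt_of_le_of_ne (by linarith) (Ne.symm hne)
      have : 0 < (1 - (w s(b, x) : ℝ)) * (Iz₀ - Ib₀) := mul_pos hpos (by linarith)
      linarith
    rw [h1, zero_mul, zero_mul]

/-- **WLOG the candidate witness is not a port** (pair champion-stability shape).  Let `x, y` be the observer pair, `b ≠ x`,
`z ≠ b`, `w₀ = w[s(b,x) ↦ 0]`.  If pair champion stability of `b` for `{x,y}` holds at `w₀` whenever `I_{w₀}(z) ≤ I_{w₀}(b)`, and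
`I_w(z) ≤ I_w(b)`, then it holds at `w`.  (Apply once more with `x ↔ y` to erase both coins of `b`.)
[cite: VandenbergHaggstromKahn2005, Thm. 1.5 — via own-edge stability] -/
theorem csPair_of_erase (w : Sym2 (Fin n) → unitInterval) (A : Finset (Fin n)) (x y b z : Fin n) (j : ℕ)
    (hbx : b ≠ x) (hzb : z ≠ b)
    (hred : (prodBernoulli (Function.update w s(b, x) 0)).real
          {ω : BondConfig (Fin n) | (A.filter fun t => ω ∈ openConn z t).card ≤ j} ≤
        (prodBernoulli (Function.update w s(b, x) 0)).real
          {ω : BondConfig (Fin n) | (A.filter fun t => ω ∈ openConn b t).card ≤ j} →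
      (prodBernoulli (Function.update w s(b, x) 0)).real
          {ω : BondConfig (Fin n) | ω ∉ openConn b x ∧ ω ∉ openConn b y ∧
            1 ≤ (A.filter fun t => ω ∈ openConn x t ∨ ω ∈ openConn y t).card ∧
            (A.filter fun t => ω ∈ openConn x t ∨ ω ∈ openConn y t).card ≤ j} ≤
        (prodBernoulli (Function.update w s(b, x) 0)).real
          {ω : BondConfig (Fin n) | ω ∉ openConn b x ∧ ω ∉ openConn b y ∧
            (A.filter fun t => ω ∈ openConn b t).card ≤ j})
    (hle : (prodBernoulli w).real {ω : BondConfig (Fin n) | (A.filter fun t => ω ∈ openConn z t).card ≤ j} ≤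
      (prodBernoulli w).real {ω : BondConfig (Fin n) | (A.filter fun t => ω ∈ openConn b t).card ≤ j}) :
    (prodBernoulli w).real
        {ω : BondConfig (Fin n) | ω ∉ openConn b x ∧ ω ∉ openConn b y ∧
          1 ≤ (A.filter fun t => ω ∈ openConn x t ∨ ω ∈ openConn y t).card ∧
          (A.filter fun t => ω ∈ openConn x t ∨ ω ∈ openConn y t).card ≤ j} ≤
      (prodBernoulli w).real
        {ω : BondConfig (Fin n) | ω ∉ openConn b x ∧ ω ∉ openConn b y ∧
          (A.filter fun t => ω ∈ openConn b t).card ≤ j} := by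
  set E₁ := {ω : BondConfig (Fin n) | ω ∉ openConn b y ∧
      1 ≤ (A.filter fun t => ω ∈ openConn x t ∨ ω ∈ openConn y t).card ∧
      (A.filter fun t => ω ∈ openConn x t ∨ ω ∈ openConn y t).card ≤ j} with hE₁
  set E₂ := {ω : BondConfig (Fin n) | ω ∉ openConn b y ∧
      (A.filter fun t => ω ∈ openConn b t).card ≤ j} with hE₂
  have e1 : {ω : BondConfig (Fin n) | ω ∉ openConn b x ∧ ω ∉ openConn b y ∧
        1 ≤ (A.filter fun t => ω ∈ openConn x t ∨ ω ∈ openConn y t).card ∧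
        (A.filter fun t => ω ∈ openConn x t ∨ ω ∈ openConn y t).card ≤ j} =
      {ω : BondConfig (Fin n) | ¬ (openGraph ω).Reachable b x} ∩ E₁ := by
    ext ω; simp only [hE₁, mem_inter_iff, mem_setOf_eq, openConn]
  have e2 : {ω : BondConfig (Fin n) | ω ∉ openConn b x ∧ ω ∉ openConn b y ∧
        (A.filter fun t => ω ∈ openConn b t).card ≤ j} =
      {ω : BondConfig (Fin n) | ¬ (openGraph ω).Reachable b x} ∩ E₂ := by
    ext ω; simp only [hE₂, mem_inter_iff, mem_setOf_eq, openConn]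
  rw [e1, e2] at hred ⊢
  exact notReach_inter_le_of_erase w A b x z j hbx hzb E₁ E₂ hred hle

/-- **Transfer of the quantitative atom (Q) from the coin-erased weights.**  Let `b ≠ x`, `z ≠ b`,
`w₀ = w[s(b,x) ↦ 0]`, and write `I_u(y) = μ_u{|π(y)| ≤ j}`.  If
`μ_{w₀}({b ≁ x} ∩ E₁) ≤ μ_{w₀}({b ≁ x} ∩ E₂) + max (I_{w₀}(z) − I_{w₀}(b)) 0`, then
`μ_w({b ≁ x} ∩ E₁) ≤ μ_w({b ≁ x} ∩ E₂) + max (I_w(z) − I_w(b)) 0`: the two events scale by `1 − w s(b,x)` (coin erasure)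
and the positive part of `z`'s lead over `b` shrinks by at most that factor (own-edge stability).  This is the reduction
"WLOG the candidate witness is not a port" for the (Q)-form of the hull-port atom (crux evidence HULLPORT-COUPLING.md §8–§9),
with no domination hypothesis at all. [cite: VandenbergHaggstromKahn2005, Thm. 1.5 — via own-edge stability] -/
theorem notReach_inter_le_add_posPart_of_erase (w : Sym2 (Fin n) → unitInterval) (A : Finset (Fin n))
    (b x z : Fin n) (j : ℕ) (hbx : b ≠ x) (hzb : z ≠ b) (E₁ E₂ : Set (BondConfig (Fin n)))
    (hred : (prodBernoulli (Function.update w s(b, x) 0)).real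
          ({ω : BondConfig (Fin n) | ¬ (openGraph ω).Reachable b x} ∩ E₁) ≤
        (prodBernoulli (Function.update w s(b, x) 0)).real
          ({ω : BondConfig (Fin n) | ¬ (openGraph ω).Reachable b x} ∩ E₂) +
        max ((prodBernoulli (Function.update w s(b, x) 0)).real
              {ω : BondConfig (Fin n) | (A.filter fun y => ω ∈ openConn z y).card ≤ j} -
            (prodBernoulli (Function.update w s(b, x) 0)).real
              {ω : BondConfig (Fin n) | (A.filter fun y => ω ∈ openConn b y).card ≤ j}) 0) :
    (prodBernoulli w).real ({ω : BondConfig (Fin n) | ¬ (openGraph ω).Reachable b x} ∩ E₁) ≤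
      (prodBernoulli w).real ({ω : BondConfig (Fin n) | ¬ (openGraph ω).Reachable b x} ∩ E₂) +
        max ((prodBernoulli w).real {ω : BondConfig (Fin n) | (A.filter fun y => ω ∈ openConn z y).card ≤ j} -
          (prodBernoulli w).real {ω : BondConfig (Fin n) | (A.filter fun y => ω ∈ openConn b y).card ≤ j}) 0 := by
  set w₀ := Function.update w s(b, x) 0 with hw₀
  set Ib₀ := (prodBernoulli w₀).real
      {ω : BondConfig (Fin n) | (A.filter fun y => ω ∈ openConn b y).card ≤ j} with hIb₀
  set Iz₀ := (prodBernoulli w₀).real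
      {ω : BondConfig (Fin n) | (A.filter fun y => ω ∈ openConn z y).card ≤ j} with hIz₀
  set Ib := (prodBernoulli w).real
      {ω : BondConfig (Fin n) | (A.filter fun y => ω ∈ openConn b y).card ≤ j} with hIb
  set Iz := (prodBernoulli w).real
      {ω : BondConfig (Fin n) | (A.filter fun y => ω ∈ openConn z y).card ≤ j} with hIz
  have hp0 : 0 ≤ (w s(b, x) : ℝ) := (w s(b, x)).2.1
  have hp1 : (w s(b, x) : ℝ) ≤ 1 := (w s(b, x)).2.2
  rw [measureReal_notReach_inter_eq_erase w b x hbx E₁, measureReal_notReach_inter_eq_erase w b x hbx E₂]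
  -- the positive part of `z`'s lead shrinks by at most `1 - w s(b,x)`
  have hpos : (1 - (w s(b, x) : ℝ)) * max (Iz₀ - Ib₀) 0 ≤ max (Iz - Ib) 0 := by
    by_cases hdom : Iz₀ ≤ Ib₀
    · rw [max_eq_right (by linarith : Iz₀ - Ib₀ ≤ 0), mul_zero]
      exact le_max_right _ _
    · have hlt : Ib₀ < Iz₀ := lt_of_not_ge hdom
      have hoes := lightness_sub_ge_of_erase_edge w A b x z j hbx hzb hlt.le
      change (1 - (w s(b, x) : ℝ)) * (Iz₀ - Ib₀) ≤ Iz - Ib at hoes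
      rw [max_eq_left (by linarith : 0 ≤ Iz₀ - Ib₀)]
      exact hoes.trans (le_max_left _ _)
  have h1 := mul_le_mul_of_nonneg_left hred (by linarith : 0 ≤ 1 - (w s(b, x) : ℝ))
  rw [mul_add] at h1
  linarith

end HullPort

end Summit.CriticalPhenomena.PercolationContinuityZ3.Theorems

end
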